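import Mathlib
import HarnessLib
import Literature.AlgebraicGeometry.Motives.CartierDivisor
import Literature.AlgebraicGeometry.Motives.AbelianVarietyDegree
import Summits.ResolutionOfSingularities.ResolutionOfSingularities.Theorems.HomologicalConductorSurfaceTerminationCentreRing

/-!
# Route `HomologicalConductor`, kill test `SurfaceTermination` (stmt-ResolutionOfSingularities-16488):
# the chart dictionary of a resolution, part 1 — sections over an open as elements of `K`, and the
# morphism from an open of the resolution to `Spec` of a subring of `K`

OURS (cell res-hironaka, crux chain W4.4, seat res-L0-w44-stub-1; object U2a «chart dictionary» of
res-D-pv-045's programme `stub_pgNonincreasing` (PG-LERAY-NOTE §1 (K2)), res-L0-w44-plan-1 rulings (ρ5),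
(ρ12a), (ρ13a)); nothing here is a statement of the manuscript under review (Hironaka 2017); AI-written,
weaker than expert review.  SUPPORT-level (kill test K4.4-s), counted 0.

Let `Z` be an integral scheme whose function field is identified with a field `K` (`e : K(Z) ≃ K`), and
`W ⊆ Z` a non-empty open.  Zariski–Samuel's dictionary «sections = rational functions regular at every
point» (Görtz–Wedhorn I, Prop. 3.29), in the vocabulary of res-L0-w44-stub-4's centre-ring file
(`…SurfaceTerminationCentreRing`: the local rings `𝒪_{Z,z} ⊆ K` are `((RatFn.toFunctionField z).range).map e`):

* §1 the VALUE `e (germ_η s) ∈ K` of a section `s ∈ Γ(W, 𝒪)` (computed on the open `W.ι '' ⊤ = W` of `Z`,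
  whose sections are `Γ(W, ⊤)` by definition): injective (`sectionVal_injective`), lands in every
  `𝒪_{Z,z}`, `z ∈ W` (`sectionVal_mem_stalkSubring`), and every element of `⋂_{z ∈ W} 𝒪_{Z,z}` is a value
  (`exists_section_of_forall_mem_stalkSubring`, Mathlib-style gluing from the tree's
  `RatFn.exists_germ_eq_of_forall_isRegularAt`);
* §2 RIGIDITY: a morphism from `W` to an affine scheme `Spec R` is determined by the values of the
  sections `σ^*(r)`, `r ∈ R` (`hom_ext_of_sectionVal`);
* §3 for a `k`-subalgebra `N ⊆ K` contained in every `𝒪_{Z,z}`, `z ∈ W`, THE morphism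
  `σ : W ⟶ Spec N` with `σ^*(y)` of value `y` (`exists_toSpec_of_forall_mem_stalkSubring`), and its
  compatibility with the structure morphism `ρ : Z ⟶ Spec T` of a `T`-model when `T ≤ N`
  (`ι_comp_eq_comp_specMap_of_sectionVal`: `W.ι ≫ ρ = σ ≫ Spec (T → N)`).

Def-free.  Part 2 (`…SurfaceTerminationChartResolution`) applies this to the preimage in a resolution of a
chart of the blowing up of the cohomology annihilator.

References: U. Görtz, T. Wedhorn, *Algebraic Geometry I* (2020), Prop. 3.29 [`GortzWedhorn2020`];
O. Zariski, P. Samuel, *Commutative Algebra* II (1960), Ch. VI §17 [`ZariskiSamuel1960`].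
-/

noncomputable section

-- single-problem summit: the doubled namespace component `ResolutionOfSingularities` is forced
set_option linter.dupNamespace false

namespace Summit.ResolutionOfSingularities.ResolutionOfSingularities.Theorems.SurfaceTermination.ChartResolution

open CategoryTheory AlgebraicGeometry TopologicalSpace Opposite
open Literature.AlgebraicGeometry.Resolution Literature.AlgebraicGeometry.Motives

variable {k K : Type} [Field k] [Field K] [Algebra k K]
variable {Z : Scheme.{0}} [IsIntegral Z] (e : ↑Z.functionField ≃+* K)

/-! ## §1 Sections over an open as elements of `K` -/

section Sections

omit [IsIntegral Z] in
/-- The open `W.ι '' ⊤` of `Z` is `W`. [folklore] -/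
theorem mem_image_top_iff (W : Z.Opens) (z : Z) : z ∈ W.ι ''ᵁ ⊤ ↔ z ∈ W := by
  rw [Scheme.Opens.ι_image_top]

/-- A non-empty open contains the generic point. [folklore] -/
theorem genericPoint_mem_image_top (W : Z.Opens) (hW : (W : Set Z).Nonempty) :
    genericPoint Z ∈ W.ι ''ᵁ ⊤ := by
  rw [Scheme.Opens.ι_image_top]
  exact ((genericPoint_spec Z).mem_open_set_iff W.isOpen).mpr (by simpa using hW)

/-- **The value of a section determines it**: `s ↦ e (germ_η s)` is injective on `Γ(W, 𝒪)` (`Z`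
integral; Görtz–Wedhorn I, Prop. 3.29 (2)). [cite: GortzWedhorn2020, Prop. 3.29] -/
theorem sectionVal_injective (W : Z.Opens) (hη : genericPoint Z ∈ W.ι ''ᵁ ⊤) :
    Function.Injective fun s : Γ(W, ⊤) =>
      e (Z.presheaf.germ (W.ι ''ᵁ ⊤) (genericPoint Z) hη s) := by
  intro s t hst
  exact germ_injective_of_isIntegral (X := Z) _ hη (e.injective hst)

/-- The value of a section lies in `𝒪_{Z,z} ⊆ K` for every `z ∈ W`. [cite: GortzWedhorn2020, Prop. 3.29] -/
theorem sectionVal_mem_stalkSubring (W : Z.Opens) (hη : genericPoint Z ∈ W.ι ''ᵁ ⊤)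
    (s : Γ(W, ⊤)) (z : Z) (hz : z ∈ W) :
    e (Z.presheaf.germ (W.ι ''ᵁ ⊤) (genericPoint Z) hη s) ∈
      ((RatFn.toFunctionField z).range).map e.toRingHom := by
  have hz' : z ∈ W.ι ''ᵁ ⊤ := (mem_image_top_iff W z).mpr hz
  refine Subring.mem_map.mpr ⟨_, ⟨Z.presheaf.germ (W.ι ''ᵁ ⊤) z hz' s, rfl⟩, ?_⟩
  change e (RatFn.toFunctionField z (Z.presheaf.germ (W.ι ''ᵁ ⊤) z hz' s)) = _
  rw [RatFn.toFunctionField_germ hz' s]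

/-- **`Γ(W, 𝒪) = ⋂_{z ∈ W} 𝒪_{Z,z}` inside `K`**: an element of `K` lying in every local ring
`𝒪_{Z,z}`, `z ∈ W`, is the value of a (unique) section over `W`. [cite: GortzWedhorn2020, Prop. 3.29] -/
theorem exists_section_of_forall_mem_stalkSubring (W : Z.Opens) (hη : genericPoint Z ∈ W.ι ''ᵁ ⊤)
    {h : K} (hh : ∀ z ∈ W, h ∈ ((RatFn.toFunctionField z).range).map e.toRingHom) :
    ∃ s : Γ(W, ⊤), e (Z.presheaf.germ (W.ι ''ᵁ ⊤) (genericPoint Z) hη s) = h := by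
  have hreg : ∀ y ∈ W.ι ''ᵁ ⊤, RatFn.IsRegularAt y (e.symm h) := by
    intro y hy
    obtain ⟨g, hg, hgh⟩ := Subring.mem_map.mp (hh y ((mem_image_top_iff W y).mp hy))
    have : e.symm h = g := by
      rw [← hgh]
      exact e.symm_apply_apply g
    rw [this]
    exact hg
  obtain ⟨s, hs⟩ := RatFn.exists_germ_eq_of_forall_isRegularAt hη hreg
  exact ⟨s, by rw [hs, RingEquiv.apply_symm_apply]⟩

end Sections

/-! ## §2 Rigidity: morphisms to an affine scheme are determined by the values of sections -/

section Rigidity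

/-- **Rigidity.** Two morphisms `σ₁, σ₂ : W ⟶ Spec R` from a non-empty open of the integral `Z`
agree as soon as the sections `σ₁^*(r)`, `σ₂^*(r)` have the same value in `K` for every `r ∈ R`
(morphisms to affine schemes are determined by global sections, Mathlib `ext_of_isAffine`, and
sections by their values). [folklore] -/
theorem hom_ext_of_sectionVal {R : CommRingCat.{0}} (W : Z.Opens) (hη : genericPoint Z ∈ W.ι ''ᵁ ⊤)
    (σ₁ σ₂ : (W : Scheme.{0}) ⟶ Spec R)
    (h : ∀ r : R,
      e (Z.presheaf.germ (W.ι ''ᵁ ⊤) (genericPoint Z) hη (σ₁.appTop ((Scheme.ΓSpecIso R).inv r))) =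
        e (Z.presheaf.germ (W.ι ''ᵁ ⊤) (genericPoint Z) hη (σ₂.appTop ((Scheme.ΓSpecIso R).inv r)))) :
    σ₁ = σ₂ := by
  refine ext_of_isAffine (CommRingCat.hom_ext (RingHom.ext fun s => ?_))
  have hs : s = (Scheme.ΓSpecIso R).inv ((Scheme.ΓSpecIso R).hom s) := by
    rw [← CommRingCat.comp_apply, Iso.hom_inv_id]; rfl
  rw [hs]
  exact sectionVal_injective e W hη (h _)

end Rigidity

/-! ## §3 The morphism to `Spec` of a subring of `K` contained in the local rings -/

section ToSpec

/-- **The morphism `W ⟶ Spec N`.**  If the `k`-subalgebra `N ⊆ K` lies in `𝒪_{Z,z}` for every point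
`z` of the non-empty open `W`, there is a morphism `σ : W ⟶ Spec N` under which the section `σ^*(y)`
has value `y` for every `y ∈ N` (the ring map `N → Γ(W, 𝒪) = ⋂_{z ∈ W} 𝒪_{Z,z}` and the `Γ ⊣ Spec`
adjunction).  By `hom_ext_of_sectionVal` it is unique with this property.
[cite: GortzWedhorn2020, Prop. 3.29; ZariskiSamuel1960, Ch. VI §17] -/
theorem exists_toSpec_of_forall_mem_stalkSubring (N : Subalgebra k K) (W : Z.Opens)
    (hη : genericPoint Z ∈ W.ι ''ᵁ ⊤)
    (hN : ∀ z ∈ W, ∀ y ∈ N, y ∈ ((RatFn.toFunctionField z).range).map e.toRingHom) :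
    ∃ σ : (W : Scheme.{0}) ⟶ Spec (.of ↥N),
      ∀ y : ↥N, e (Z.presheaf.germ (W.ι ''ᵁ ⊤) (genericPoint Z) hη
        (σ.appTop ((Scheme.ΓSpecIso (.of ↥N)).inv y))) = (y : K) := by
  classical
  -- the section with value `y`
  have hex : ∀ y : ↥N, ∃ s : Γ(W, ⊤),
      e (Z.presheaf.germ (W.ι ''ᵁ ⊤) (genericPoint Z) hη s) = (y : K) :=
    fun y => exists_section_of_forall_mem_stalkSubring e W hη (fun z hz => hN z hz y y.2)
  choose φ₀ hφ₀ using hex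
  have hinj := sectionVal_injective e W hη
  -- it is a ring homomorphism (values are multiplicative and additive, and determine sections)
  let φ : ↥N →+* Γ(W, ⊤) :=
    { toFun := φ₀
      map_one' := hinj (by
        change e (Z.presheaf.germ (W.ι ''ᵁ ⊤) (genericPoint Z) hη (φ₀ 1)) =
          e (Z.presheaf.germ (W.ι ''ᵁ ⊤) (genericPoint Z) hη 1)
        rw [hφ₀, map_one, map_one, OneMemClass.coe_one])
      map_mul' := fun a b => hinj (by
        change e (Z.presheaf.germ (W.ι ''ᵁ ⊤) (genericPoint Z) hη (φ₀ (a * b))) =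
          e (Z.presheaf.germ (W.ι ''ᵁ ⊤) (genericPoint Z) hη (φ₀ a * φ₀ b))
        rw [hφ₀, MulMemClass.coe_mul]
        erw [map_mul, map_mul]
        rw [hφ₀, hφ₀])
      map_zero' := hinj (by
        change e (Z.presheaf.germ (W.ι ''ᵁ ⊤) (genericPoint Z) hη (φ₀ 0)) =
          e (Z.presheaf.germ (W.ι ''ᵁ ⊤) (genericPoint Z) hη 0)
        rw [hφ₀, map_zero, map_zero, ZeroMemClass.coe_zero])
      map_add' := fun a b => hinj (by
        change e (Z.presheaf.germ (W.ι ''ᵁ ⊤) (genericPoint Z) hη (φ₀ (a + b))) =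
          e (Z.presheaf.germ (W.ι ''ᵁ ⊤) (genericPoint Z) hη (φ₀ a + φ₀ b))
        rw [hφ₀, AddMemClass.coe_add]
        erw [map_add, map_add]
        rw [hφ₀, hφ₀]) }
  refine ⟨(W : Scheme.{0}).toSpecΓ ≫ Spec.map (CommRingCat.ofHom φ), fun y => ?_⟩
  have h2 : (Scheme.ΓSpecIso (.of ↥N)).hom ((Scheme.ΓSpecIso (.of ↥N)).inv y) = y := by
    rw [← CommRingCat.comp_apply, Iso.inv_hom_id]; rfl
  have happ : ((W : Scheme.{0}).toSpecΓ ≫ Spec.map (CommRingCat.ofHom φ)).appTop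
      ((Scheme.ΓSpecIso (.of ↥N)).inv y) = φ y := by
    rw [Scheme.Hom.comp_appTop, Scheme.toSpecΓ_appTop]
    calc ((Spec.map (CommRingCat.ofHom φ)).appTop ≫ (Scheme.ΓSpecIso Γ(W, ⊤)).hom)
          ((Scheme.ΓSpecIso (.of ↥N)).inv y)
        = ((Scheme.ΓSpecIso (.of ↥N)).hom ≫ CommRingCat.ofHom φ)
            ((Scheme.ΓSpecIso (.of ↥N)).inv y) := by rw [Scheme.ΓSpecIso_naturality]
      _ = φ ((Scheme.ΓSpecIso (.of ↥N)).hom ((Scheme.ΓSpecIso (.of ↥N)).inv y)) := rfl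
      _ = φ y := by rw [h2]
  rw [happ]
  exact hφ₀ y

variable (T : Subalgebra k K) (ρ : Z ⟶ Spec (.of ↥T))
  (he : ∀ t : ↥T, e (baseToFunctionField ρ t) = (t : K))
include he

/-- The value of the structure section `ρ^*(t)|_W` is `t`. [folklore] -/
theorem sectionVal_ι_comp (W : Z.Opens) (hη : genericPoint Z ∈ W.ι ''ᵁ ⊤) (t : ↥T) :
    e (Z.presheaf.germ (W.ι ''ᵁ ⊤) (genericPoint Z) hη
      ((W.ι ≫ ρ).appTop ((Scheme.ΓSpecIso (.of ↥T)).inv t))) = (t : K) := by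
  rw [← he t]
  congr 1
  rw [Scheme.Hom.comp_appTop, CommRingCat.comp_apply, Scheme.Opens.ι_appTop]
  change (Z.presheaf.germ (W.ι ''ᵁ ⊤) (genericPoint Z) hη)
      ((Z.presheaf.map (homOfLE le_top).op) (ρ.appTop ((Scheme.ΓSpecIso (.of ↥T)).inv t))) = _
  rw [TopCat.Presheaf.germ_res_apply]
  rfl

/-- **Compatibility with the structure morphism.**  If `T ≤ N` and `σ : W ⟶ Spec N` gives every
`σ^*(y)` the value `y`, then `W.ι ≫ ρ = σ ≫ Spec (T → N)` (rigidity: both give `t ∈ T` the value `t`).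
[folklore] -/
theorem ι_comp_eq_comp_specMap_of_sectionVal (N : Subalgebra k K) (hTN : T ≤ N) (W : Z.Opens)
    (hη : genericPoint Z ∈ W.ι ''ᵁ ⊤) (σ : (W : Scheme.{0}) ⟶ Spec (.of ↥N))
    (hσ : ∀ y : ↥N, e (Z.presheaf.germ (W.ι ''ᵁ ⊤) (genericPoint Z) hη
      (σ.appTop ((Scheme.ΓSpecIso (.of ↥N)).inv y))) = (y : K)) :
    W.ι ≫ ρ = σ ≫ Spec.map (CommRingCat.ofHom (Subalgebra.inclusion hTN).toRingHom) := by
  refine hom_ext_of_sectionVal e W hη _ _ fun t => ?_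
  have hnat : (Spec.map (CommRingCat.ofHom (Subalgebra.inclusion hTN).toRingHom)).appTop
      ((Scheme.ΓSpecIso (.of ↥T)).inv t) =
        (Scheme.ΓSpecIso (.of ↥N)).inv (Subalgebra.inclusion hTN t) := by
    change ((Scheme.ΓSpecIso (.of ↥T)).inv ≫ (Spec.map (CommRingCat.ofHom
      (Subalgebra.inclusion hTN).toRingHom)).appTop) t = _
    rw [← Scheme.ΓSpecIso_inv_naturality]
    rfl
  rw [sectionVal_ι_comp e T ρ he W hη t, Scheme.Hom.comp_appTop, CommRingCat.comp_apply, hnat]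
  exact (hσ (Subalgebra.inclusion hTN t)).symm

end ToSpec

end Summit.ResolutionOfSingularities.ResolutionOfSingularities.Theorems.SurfaceTermination.ChartResolution

end
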